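import Summits.CriticalPhenomena.PercolationContinuityZ3.Theorems.PercNearOneGluingNoHeavyLowerTailFrontierDecRowsClusterMarkovCore
import Summits.CriticalPhenomena.PercolationContinuityZ3.Theorems.PercNearOneGluingNoHeavyLowerTailFrontierDecRowsClusterBHK3Defs
import Literature.Probability.Percolation.TwoClusterConditionalAssociationProofs
import HarnessLib

/-!
# The cluster-Markov / BHK criterion for ARBITRARY cluster-monotone events:
# `E₃(a₁, a₂, {s ↮ X}) ≥ 0` whenever `aᵢ` is a decreasing function of the open cluster `C_{Sᵢ}` alone and `Sᵢ ⊆ X`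

Support file (prover prim-ineq-prove-3 gen 12; `--supports stmt-CriticalPhenomena-4575`).  No definitions, no named facts, no sorries,
no `native_decide`.  New mathematics (a generalisation of the tree's criterion, not in print).

`…FrontierDecRowsClusterMarkovCore` (prim-l12-p1) proves `0 ≤ E₃(D[P|Q], D[P'|Q'], {s ↮ X})` for SEPARATION events with `Q, Q' ⊆ X`
(`ClusterMarkovE3.sahiE3_sep_sep_notReach_nonneg`), which closes 27 of the 37 unimplied orbits of the four-point decreasing cubic frontier.
Its two percolation inputs are local: (1) block independence off the cluster of `s` + Harris in the fresh configuration, (2) BHK Thm 1.3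
(`…twoLocal_posCorrelation`, stated there for two bounded antitone LOCAL statistics).  This file records that the locality hypothesis holds for
EVERY event that is a decreasing function of the open edge cluster `C_{S₁} = ⋃_{v ∈ S₁} C_v` of a source set `S₁ ⊆ X`: on `{s ↮ X}` the pairs
meeting the cluster of `s` are disjoint from `C_{S₁}`, so deleting them does not change `C_{S₁}` (`biUnion_openEdgeCluster_sdiff_bar`, from
`BHK2006.openEdgeCluster_eq_sdiff_bar`).  Hence:

**Theorem (`sahiE3_clusterAnti_clusterAnti_notReach_nonneg`).**  For Bernoulli bond percolation with arbitrary edge weights on a finite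
vertex type, a vertex `s`, vertex sets `X ⊇ S₁, S₂`, and events `a₁, a₂` with `aᵢ` closed under SHRINKING `C_{Sᵢ}` (a decreasing
function of the cluster of `Sᵢ` alone — e.g. `D[P|Q]` with `Q = Sᵢ`, `{C_{Sᵢ} ∌ e}`, "fewer than `k` vertices of `Z` are joined to `Sᵢ`", the
complement of any cluster-monotone event of the conjecture `ClusterBHK3Pos`):  `0 ≤ E₃(a₁, a₂, {s ↮ X})`, and `a₁, a₂` are positively
correlated given `{s ↮ X}`.

Corollaries in the vocabulary of Conjecture G⁺ (`…ClusterBHK3Defs`): for `A` increasing in `C_S` and `B` increasing in `C_{S'}` with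
`S, S' ⊆ X`, `0 ≤ E₃(Aᶜ, Bᶜ, {s ↮ X})` (`sahiE3_clusterMonoCompl_clusterMonoCompl_notReach_nonneg`); and for terminal sets `S, T`, a
vertex `y` and `A` increasing in `C_S`, `0 ≤ E₃({S ↮ T}, Aᶜ, {y ↮ S ∪ T})` (`sahiE3_sep_clusterMonoCompl_notReachUnion_nonneg`) — the
nonnegative part of the decomposition `E₃({S↮T}, Aᶜ, {T ↮ y}) = E₃({S↮T}, Aᶜ, {y ↮ S∪T}) + E₃({S↮T}, Aᶜ, {S ↔ y ↮ T})` of the hitting-type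
instances of G⁺ (prim-ineq-prove-3 gen 12 memo FINDING-G12; the second summand is signed and carries the whole difficulty of the PATH row).
-/

noncomputable section

namespace Summit.CriticalPhenomena.PercolationContinuityZ3.Theorems

namespace ClusterMarkovE3

open MeasureTheory Literature.Probability.Percolation Literature.Probability.LatticeModels
open BHK2006 DecisionTree LonePortSum LonePortSumGeneral
open scoped Classical

variable {V : Type*} [Fintype V]

/-! ### Locality of the cluster of a source set off the bar of `C_s` -/

omit [Fintype V] in
/-- **Locality**: if no vertex of `S₁` is joined to `s`, then deleting the pairs meeting the cluster of `s` does not change the open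
edge cluster `C_{S₁} = ⋃_{v ∈ S₁} C_v`. [cite: VandenbergHaggstromKahn2005, §1 p. 8 (conditioning on `{C_s = W}`); this form: this work] -/
theorem biUnion_openEdgeCluster_sdiff_bar (s : V) (S₁ : Set V) (ω : BondConfig V)
    (hS : ∀ v ∈ S₁, ¬ (openGraph ω).Reachable s v) :
    (⋃ v ∈ S₁, openEdgeCluster (ω \ {e | ∃ u ∈ e, u = s ∨ ∃ e' ∈ openEdgeCluster ω s, u ∈ e'}) v) =
      ⋃ v ∈ S₁, openEdgeCluster ω v := by
  refine Set.iUnion₂_congr fun v hv => ?_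
  have hvs : ¬ (v = s ∨ ∃ e ∈ openEdgeCluster ω s, v ∈ e) := fun h =>
    hS v hv ((reachable_iff_exists_mem_openEdgeCluster ω s v).2 h)
  exact (openEdgeCluster_eq_sdiff_bar (rfl : openEdgeCluster ω s = openEdgeCluster ω s) hvs).symm

omit [Fintype V] in
/-- **Locality of cluster-antitone events**: on `{s ↮ X}`, an event closed under shrinking `C_{S₁}` with `S₁ ⊆ X` is read off the
configuration with the pairs meeting the cluster of `s` deleted. [this work] -/
theorem ind_clusterAnti_sdiff_bar (s : V) (X S₁ : Set V) (hS₁ : S₁ ⊆ X) (a : Set (BondConfig V))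
    (ha : ∀ ⦃ω ω' : BondConfig V⦄,
      (⋃ v ∈ S₁, openEdgeCluster ω v) ⊆ (⋃ v ∈ S₁, openEdgeCluster ω' v) → ω' ∈ a → ω ∈ a)
    (ω : BondConfig V) (hω : ∀ x ∈ X, ¬ (openGraph ω).Reachable s x) :
    ind a (ω \ {e | ∃ u ∈ e, u = s ∨ ∃ e' ∈ openEdgeCluster ω s, u ∈ e'}) = ind a ω := by
  have hloc := biUnion_openEdgeCluster_sdiff_bar s S₁ ω fun v hv => hω v (hS₁ hv)
  have key : (ω \ {e | ∃ u ∈ e, u = s ∨ ∃ e' ∈ openEdgeCluster ω s, u ∈ e'}) ∈ a ↔ ω ∈ a :=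
    ⟨fun h => ha (subset_of_eq hloc.symm) h, fun h => ha (subset_of_eq hloc) h⟩
  by_cases h : ω ∈ a
  · rw [ind_of_mem h, ind_of_mem (key.2 h)]
  · rw [ind_of_not_mem h, ind_of_not_mem (fun h' => h (key.1 h'))]

omit [Fintype V] in
/-- An event closed under shrinking `C_{S₁}` is a lower set. [folklore] -/
theorem isLowerSet_of_clusterAnti (S₁ : Set V) (a : Set (BondConfig V))
    (ha : ∀ ⦃ω ω' : BondConfig V⦄,
      (⋃ v ∈ S₁, openEdgeCluster ω v) ⊆ (⋃ v ∈ S₁, openEdgeCluster ω' v) → ω' ∈ a → ω ∈ a) :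
    IsLowerSet a :=
  fun _ _ hle hω => ha (FrontierDecRows.biUnion_openEdgeCluster_mono S₁ hle) hω

omit [Fintype V] in
/-- The indicator of a lower set is antitone. [folklore] -/
theorem ind_antitone_of_isLowerSet {a : Set (BondConfig V)} (ha : IsLowerSet a) : Antitone (ind a) := by
  intro ω ω' hle
  by_cases h : ω' ∈ a
  · rw [ind_of_mem h, ind_of_mem (ha hle h)]
  · rw [ind_of_not_mem h]; exact ind_nonneg _ _

/-! ### Conditional positive correlation and `E₃ ≥ 0` -/

/-- **Two cluster-antitone events are positively correlated given `{s ↮ X}`** (product form, no side conditions): for `S₁, S₂ ⊆ X` and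
`aᵢ` closed under shrinking `C_{Sᵢ}`,  `μ(D_X ∩ a₁) · μ(D_X ∩ a₂) ≤ μ(D_X) · μ(D_X ∩ a₁ ∩ a₂)`, `D_X = {s ↮ X}`. [this work] -/
theorem clusterAnti_clusterAnti_posCorrelation_notReach (w : Sym2 V → unitInterval) (s : V) (X S₁ S₂ : Set V)
    (hS₁ : S₁ ⊆ X) (hS₂ : S₂ ⊆ X) (a₁ a₂ : Set (BondConfig V))
    (ha₁ : ∀ ⦃ω ω' : BondConfig V⦄,
      (⋃ v ∈ S₁, openEdgeCluster ω v) ⊆ (⋃ v ∈ S₁, openEdgeCluster ω' v) → ω' ∈ a₁ → ω ∈ a₁)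
    (ha₂ : ∀ ⦃ω ω' : BondConfig V⦄,
      (⋃ v ∈ S₂, openEdgeCluster ω v) ⊆ (⋃ v ∈ S₂, openEdgeCluster ω' v) → ω' ∈ a₂ → ω ∈ a₂) :
    (prodBernoulli w).real ({ω : BondConfig V | ∀ x ∈ X, ¬ (openGraph ω).Reachable s x} ∩ a₁) *
      (prodBernoulli w).real ({ω : BondConfig V | ∀ x ∈ X, ¬ (openGraph ω).Reachable s x} ∩ a₂) ≤
    (prodBernoulli w).real {ω : BondConfig V | ∀ x ∈ X, ¬ (openGraph ω).Reachable s x} *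
      (prodBernoulli w).real ({ω : BondConfig V | ∀ x ∈ X, ¬ (openGraph ω).Reachable s x} ∩ (a₁ ∩ a₂)) := by
  classical
  by_cases hs : s ∈ X
  · have hempty : {ω : BondConfig V | ∀ x ∈ X, ¬ (openGraph ω).Reachable s x} = ∅ := by
      ext ω
      simp only [Set.mem_setOf_eq, Set.mem_empty_iff_false, iff_false, not_forall, not_not]
      exact ⟨s, hs, SimpleGraph.Reachable.refl _⟩
    rw [hempty]
    simp
  have h := twoLocal_posCorrelation w s X hs (ind a₁) (ind a₂)
    (ind_antitone_of_isLowerSet (isLowerSet_of_clusterAnti S₁ a₁ ha₁))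
    (ind_antitone_of_isLowerSet (isLowerSet_of_clusterAnti S₂ a₂ ha₂))
    (fun ω => ind_le_one _ _) (fun ω => ind_le_one _ _)
    (fun ω hω => ind_clusterAnti_sdiff_bar s X S₁ hS₁ a₁ ha₁ ω hω)
    (fun ω hω => ind_clusterAnti_sdiff_bar s X S₂ hS₂ a₂ ha₂ ω hω)
  have hprod : (fun ω : BondConfig V => ind a₁ ω * ind a₂ ω) = fun ω => ind (a₁ ∩ a₂) ω :=
    funext fun ω => (ind_inter _ _ ω).symm
  rw [hprod, setIntegral_ind_eq, setIntegral_ind_eq, setIntegral_ind_eq] at h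
  exact h

/-- **THEOREM (cluster-Markov / BHK criterion, cluster-antitone form).**  For every finite weighted graph, vertex `s`, vertex sets
`S₁, S₂ ⊆ X` and events `a₁, a₂` with `aᵢ` closed under shrinking the open edge cluster `C_{Sᵢ}`:
`0 ≤ E₃(a₁, a₂, {s ↮ X})`. [this work] -/
theorem sahiE3_clusterAnti_clusterAnti_notReach_nonneg (w : Sym2 V → unitInterval) (s : V) (X S₁ S₂ : Set V)
    (hS₁ : S₁ ⊆ X) (hS₂ : S₂ ⊆ X) (a₁ a₂ : Set (BondConfig V))
    (ha₁ : ∀ ⦃ω ω' : BondConfig V⦄,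
      (⋃ v ∈ S₁, openEdgeCluster ω v) ⊆ (⋃ v ∈ S₁, openEdgeCluster ω' v) → ω' ∈ a₁ → ω ∈ a₁)
    (ha₂ : ∀ ⦃ω ω' : BondConfig V⦄,
      (⋃ v ∈ S₂, openEdgeCluster ω v) ⊆ (⋃ v ∈ S₂, openEdgeCluster ω' v) → ω' ∈ a₂ → ω ∈ a₂) :
    0 ≤ sahiE3 (prodBernoulli w) a₁ a₂ {ω : BondConfig V | ∀ x ∈ X, ¬ (openGraph ω).Reachable s x} := by
  have hD : IsLowerSet {ω : BondConfig V | ∀ x ∈ X, ¬ (openGraph ω).Reachable s x} := by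
    rw [← sepEv_singleton]; exact isLowerSet_sepEv _ _
  refine prodBernoulli_sahiE3_nonneg_of_condHarris_lower w (isLowerSet_of_clusterAnti S₁ a₁ ha₁)
    (isLowerSet_of_clusterAnti S₂ a₂ ha₂) hD MeasurableSet.of_discrete MeasurableSet.of_discrete MeasurableSet.of_discrete ?_
  have h := clusterAnti_clusterAnti_posCorrelation_notReach w s X S₁ S₂ hS₁ hS₂ a₁ a₂ ha₁ ha₂
  rw [Set.inter_comm _ a₁, Set.inter_comm _ a₂, Set.inter_comm _ (a₁ ∩ a₂)] at h
  exact h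

/-- The same with the conditioning event `{s ↮ X}` in the MIDDLE slot. [this work] -/
theorem sahiE3_clusterAnti_notReach_clusterAnti_nonneg (w : Sym2 V → unitInterval) (s : V) (X S₁ S₂ : Set V)
    (hS₁ : S₁ ⊆ X) (hS₂ : S₂ ⊆ X) (a₁ a₂ : Set (BondConfig V))
    (ha₁ : ∀ ⦃ω ω' : BondConfig V⦄,
      (⋃ v ∈ S₁, openEdgeCluster ω v) ⊆ (⋃ v ∈ S₁, openEdgeCluster ω' v) → ω' ∈ a₁ → ω ∈ a₁)
    (ha₂ : ∀ ⦃ω ω' : BondConfig V⦄,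
      (⋃ v ∈ S₂, openEdgeCluster ω v) ⊆ (⋃ v ∈ S₂, openEdgeCluster ω' v) → ω' ∈ a₂ → ω ∈ a₂) :
    0 ≤ sahiE3 (prodBernoulli w) a₁ {ω : BondConfig V | ∀ x ∈ X, ¬ (openGraph ω).Reachable s x} a₂ := by
  rw [sahiE3_comm₂₃]
  exact sahiE3_clusterAnti_clusterAnti_notReach_nonneg w s X S₁ S₂ hS₁ hS₂ a₁ a₂ ha₁ ha₂

/-- The same with the conditioning event `{s ↮ X}` in the FIRST slot. [this work] -/
theorem sahiE3_notReach_clusterAnti_clusterAnti_nonneg (w : Sym2 V → unitInterval) (s : V) (X S₁ S₂ : Set V)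
    (hS₁ : S₁ ⊆ X) (hS₂ : S₂ ⊆ X) (a₁ a₂ : Set (BondConfig V))
    (ha₁ : ∀ ⦃ω ω' : BondConfig V⦄,
      (⋃ v ∈ S₁, openEdgeCluster ω v) ⊆ (⋃ v ∈ S₁, openEdgeCluster ω' v) → ω' ∈ a₁ → ω ∈ a₁)
    (ha₂ : ∀ ⦃ω ω' : BondConfig V⦄,
      (⋃ v ∈ S₂, openEdgeCluster ω v) ⊆ (⋃ v ∈ S₂, openEdgeCluster ω' v) → ω' ∈ a₂ → ω ∈ a₂) :
    0 ≤ sahiE3 (prodBernoulli w) {ω : BondConfig V | ∀ x ∈ X, ¬ (openGraph ω).Reachable s x} a₁ a₂ := by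
  rw [sahiE3_comm₁₂]
  exact sahiE3_clusterAnti_notReach_clusterAnti_nonneg w s X S₁ S₂ hS₁ hS₂ a₁ a₂ ha₁ ha₂

/-! ### Corollaries in the vocabulary of Conjecture G⁺ (`ClusterBHK3Pos`) -/

omit [Fintype V] in
/-- The complement of an event closed under ENLARGING `C_S` is closed under SHRINKING `C_S`. [folklore] -/
theorem compl_clusterAnti_of_clusterMono (S : Set V) (A : Set (BondConfig V))
    (hA : ∀ ⦃ω ω' : BondConfig V⦄,
      (⋃ v ∈ S, openEdgeCluster ω v) ⊆ (⋃ v ∈ S, openEdgeCluster ω' v) → ω ∈ A → ω' ∈ A) :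
    ∀ ⦃ω ω' : BondConfig V⦄,
      (⋃ v ∈ S, openEdgeCluster ω v) ⊆ (⋃ v ∈ S, openEdgeCluster ω' v) → ω' ∈ Aᶜ → ω ∈ Aᶜ :=
  fun _ _ hsub hω' hω => hω' (hA hsub hω)

omit [Fintype V] in
/-- The separation event `{S ↮ T}` is closed under shrinking `C_S`: an open `S–T` path gives a pair of `C_S` containing the endpoint
in `T` (or the endpoint lies in `S`). [folklore] -/
theorem sepEv_clusterAnti (S T : Set V) :
    ∀ ⦃ω ω' : BondConfig V⦄,
      (⋃ v ∈ S, openEdgeCluster ω v) ⊆ (⋃ v ∈ S, openEdgeCluster ω' v) →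
      ω' ∈ {ω : BondConfig V | ∀ p ∈ S, ∀ q ∈ T, ¬ (openGraph ω).Reachable p q} →
      ω ∈ {ω : BondConfig V | ∀ p ∈ S, ∀ q ∈ T, ¬ (openGraph ω).Reachable p q} := by
  intro ω ω' hsub hω' p hp q hq hreach
  rcases (reachable_iff_exists_mem_openEdgeCluster ω p q).1 hreach with hqp | ⟨e, he, hqe⟩
  · subst hqp
    exact hω' q hp q hq (SimpleGraph.Reachable.refl _)
  · have he' : e ∈ ⋃ v ∈ S, openEdgeCluster ω' v := hsub (Set.mem_biUnion hp he)
    rcases Set.mem_iUnion₂.1 he' with ⟨p', hp', hep'⟩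
    exact hω' p' hp' q hq ((reachable_iff_exists_mem_openEdgeCluster ω' p' q).2 (Or.inr ⟨e, hep', hqe⟩))

/-- **G⁺-vocabulary form**: for `A` increasing in `C_S`, `B` increasing in `C_{S'}` (the hypothesis class of `ClusterBHK3Pos`) and
`S, S' ⊆ X`:  `0 ≤ E₃(Aᶜ, Bᶜ, {s ↮ X})`. [this work] -/
theorem sahiE3_clusterMonoCompl_clusterMonoCompl_notReach_nonneg (w : Sym2 V → unitInterval) (s : V) (X S S' : Set V)
    (hS : S ⊆ X) (hS' : S' ⊆ X) (A B : Set (BondConfig V))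
    (hA : ∀ ⦃ω ω' : BondConfig V⦄,
      (⋃ v ∈ S, openEdgeCluster ω v) ⊆ (⋃ v ∈ S, openEdgeCluster ω' v) → ω ∈ A → ω' ∈ A)
    (hB : ∀ ⦃ω ω' : BondConfig V⦄,
      (⋃ v ∈ S', openEdgeCluster ω v) ⊆ (⋃ v ∈ S', openEdgeCluster ω' v) → ω ∈ B → ω' ∈ B) :
    0 ≤ sahiE3 (prodBernoulli w) Aᶜ Bᶜ {ω : BondConfig V | ∀ x ∈ X, ¬ (openGraph ω).Reachable s x} :=
  sahiE3_clusterAnti_clusterAnti_notReach_nonneg w s X S S' hS hS' Aᶜ Bᶜ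
    (compl_clusterAnti_of_clusterMono S A hA) (compl_clusterAnti_of_clusterMono S' B hB)

/-- **The nonnegative part of the hitting-type instances of G⁺**: for terminal sets `S, T`, a vertex `y` and `A` increasing in `C_S`,
`0 ≤ E₃({S ↮ T}, Aᶜ, {y ↮ S ∪ T})` (criterion with `X = S ∪ T`; both other events are antitone in `C_S`). [this work] -/
theorem sahiE3_sep_clusterMonoCompl_notReachUnion_nonneg (w : Sym2 V → unitInterval) (S T : Set V) (y : V)
    (A : Set (BondConfig V))
    (hA : ∀ ⦃ω ω' : BondConfig V⦄,
      (⋃ v ∈ S, openEdgeCluster ω v) ⊆ (⋃ v ∈ S, openEdgeCluster ω' v) → ω ∈ A → ω' ∈ A) :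
    0 ≤ sahiE3 (prodBernoulli w) {ω : BondConfig V | ∀ p ∈ S, ∀ q ∈ T, ¬ (openGraph ω).Reachable p q} Aᶜ
      {ω : BondConfig V | ∀ x ∈ S ∪ T, ¬ (openGraph ω).Reachable y x} :=
  sahiE3_clusterAnti_clusterAnti_notReach_nonneg w y (S ∪ T) S S Set.subset_union_left Set.subset_union_left
    {ω : BondConfig V | ∀ p ∈ S, ∀ q ∈ T, ¬ (openGraph ω).Reachable p q} Aᶜ
    (sepEv_clusterAnti S T) (compl_clusterAnti_of_clusterMono S A hA)

end ClusterMarkovE3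

end Summit.CriticalPhenomena.PercolationContinuityZ3.Theorems
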